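import Literature.AlgebraicGeometry.Motives.HodgeLieUnitaryTimesCMCurveSU
import Literature.AlgebraicGeometry.HodgeTheory.UnitaryHodgeGroupOfRibetTypeTwoThree
import Literature.AlgebraicGeometry.HodgeTheory.WeilTypeHodgeGroupSemisimpleOfCentre
import Literature.AlgebraicGeometry.Motives.HodgeLieOfAbelianVarietySemisimpleTimesCM
import HarnessLib

/-!
# `H¹(E_K × E_K)`: an operator commuting with `End(E × E)^*_ℂ` and `ψ_ℂ`-skew is a multiple of the diagonal `K`-action, hence lies in
# `Lie Hg(H¹(E × E)) ⊗ ℂ = ℂ Φ^*_ℂ`; `Lie Hg(H¹(E × E))` is commutative — the ROW-20 factor file (TABLE X, `A ∼ Y₄ × E_K²`)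

Family `hodge`, layer `Literature/AlgebraicGeometry/HodgeTheory` (cell `pub-hodgeav-hg6`, req-37 (A) Q2b, TABLE X Weil PRODUCT ROW 20; eng-5 g7,
brick F20 of the lead's ruling 2026-08-29T08:35Z). UNCONDITIONAL; theorems only, no definition, no named fact, no instance, no `sorry`. HONEST
FRAMING of that cell: HC ∕ HC_AV (stmt-1333) ∕ HC_CM (stmt-3052) ∕ H2 NOT proved — statements about `Lie Hg(E × E)` only.

SETTING. `E` a complex elliptic curve (`dim E = 1`) with `χ : E ⟶ E`, `χ ≫ χ = −d` (`d > 0`; CM by `K = ℚ(√−d)`), `Φ` the diagonal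
endomorphism of `E × E` (`Φ ≫ fst = fst ≫ χ`, `Φ ≫ snd = snd ≫ χ`), `ψ` a polarization of `H¹(E × E; ℚ)`. Through the bicone
`H¹(E × E) = fst^* H¹(E) ⊕ snd^* H¹(E)` (`pull_pull_eq_self_of_comp_eq_id`, `pull_pull_add_pull_pull_eq_self`) an operator `Z` of
`H¹(E × E; ℂ)` commuting with the pull-backs of the four «matrix units» `fst ≫ prodLift 𝟙 0`, `fst ≫ prodLift 0 𝟙`, `fst ≫ χ ≫ prodLift 𝟙 0`, …
of `End(E × E) ⊇ M₂(K)` is block-diagonal with EQUAL blocks commuting with `χ^*_ℂ`; each block is skew for the restricted polarization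
(`WeilProductCM.exists_polarization_comp`), hence a multiple of `χ^*_ℂ` (`RankTwoCM.exists_eq_smul_of_commute_of_skew`: `𝔲_K(H¹E)_ℂ = ℂ χ^*_ℂ`).

* **`CMCurveSq.exists_eq_smul_of_commute_of_skew`** (F20a) — such a `Z` is `y • Φ^*_ℂ` («the `ψ`-skew commutant of `M₂(K)_ℂ` is
  `K⁻_ℂ = ℂ Φ^*_ℂ`»).
* **`CMCurveSq.mem_hodgeLieC_of_commute_of_skew`** (F20a′) — such a `Z` lies in `Lie Hg(H¹(E × E)) ⊗ ℂ` (the Hodge operator `Θ` is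
  `c Φ^*_ℂ` with `c ≠ 0` by F20a, and `Θ ∈ Lie Hg ⊗ ℂ`); this is the hypothesis `hY₂` of the product brick
  `WeilProductCM.mem_hodgeLieC_of_commute_of_skew_of_trace_of_abelian` (eng-3 g4, v1.2) at `H₂ = H¹(E_K²)`.
* **`CMCurveSq.hodgeLie_mul_comm`** (F20b) — `Lie Hg(H¹(E × E))` is commutative (every element is a rational multiple of `Φ^*`,
  rational descent `exists_eq_ratCast_smul_of_baseChange_eq_smul`); the hypothesis `hab₂` of that brick.

## References
* [MoonenZarhin1999LowDim] B. Moonen, Yu. Zarhin, Math. Ann. 315 (1999), §2 (2.1), §3 Lemma (3.6), Prop. (3.8) («`Hg(E^k) = U_K(1)`»).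
* [Deligne1982HodgeCycles] P. Deligne, LNM 900 (1982), I §3 Prop. 3.4; §4 (p. 30).
* [VoisinHodgeI2002] C. Voisin, Hodge Theory I (2002), §7.3.2, Lemma 7.26.
-/

noncomputable section

open scoped TensorProduct
open CategoryTheory CategoryTheory.Limits Module

namespace Literature.AlgebraicGeometry.HodgeTheory

open Literature.AlgebraicTopology.SingularHomology
open Literature.AlgebraicGeometry.Motives
open Literature.AlgebraicGeometry.Motives.AbelianVariety
open Literature.AlgebraicGeometry.Motives.HodgeStructure
open Literature.AlgebraicGeometry.ComplexMultiplication (bettiRep bettiRep_of bettiCohomology_map_comp_hom)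

variable {E : AbelianVariety ℂ}

/-- `(f ≫ g)^* = f^* ∘ g^*` on `H¹(−; ℚ)`, for the linear maps. [folklore] -/
private theorem CMCurveSq.pull_comp_eq {A B C : AbelianVariety ℂ} (f : A ⟶ B) (g : B ⟶ C) :
    BettiUniverse.pull (f ≫ g).hom.hom.hom 1 = BettiUniverse.pull f.hom.hom.hom 1 ∘ₗ BettiUniverse.pull g.hom.hom.hom 1 := by
  change (bettiCohomology.map (f ≫ g).hom.hom.hom 1).hom = _
  rw [bettiCohomology_map_comp_hom, ModuleCat.hom_comp]

/-- **F20a — the `ψ_ℂ`-skew commutant of `End(E_K × E_K)^*_ℂ` on `H¹(E × E; ℂ)` is the line `ℂ Φ^*_ℂ`** (`Φ` the diagonal `K`-action):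
an operator `Z` commuting with every `f^*_ℂ`, `f ∈ End(E × E)`, and skew for a polarization `ψ` is `y • Φ^*_ℂ`. (Blocks along the bicone
are equal and commute with `χ^*_ℂ`; each is skew for the restricted polarization, hence in `ℂ χ^*_ℂ` — «`Lie U_K(1) ⊗ ℂ`».)
[cite: MoonenZarhin1999LowDim, §2 (2.1) and §3 Prop. (3.8)] [cite: VoisinHodgeI2002, Lemma 7.26] -/
theorem CMCurveSq.exists_eq_smul_of_commute_of_skew [HodgeTensorFacts.{0, 0}]
    (hE1 : E.dim = 1) (χ : E ⟶ E) {d : ℕ} (hd : 0 < d) (hχ : χ ≫ χ = -(d • 𝟙 E))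
    (Φ : E.prod E ⟶ E.prod E) (hΦ₁ : Φ ≫ fst E E = fst E E ≫ χ) (hΦ₂ : Φ ≫ snd E E = snd E E ≫ χ)
    (ψ : (BettiUniverse.hodge exists_isReal_hodgeModel_holds (AbelianVariety.isSmoothProjective_holds (A := E.prod E)) 1).Polarization)
    {Z : Module.End ℂ (ℂ ⊗[ℚ] bettiCohomology (E.prod E).X 1)}
    (hZ : ∀ f : E.prod E ⟶ E.prod E,
      Z * ((bettiCohomology.map f.hom.hom.hom 1).hom).baseChange ℂ = ((bettiCohomology.map f.hom.hom.hom 1).hom).baseChange ℂ * Z)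
    (hZskew : ∀ x y, ψ.form.baseChange ℂ (Z x) y + ψ.form.baseChange ℂ x (Z y) = 0) :
    ∃ y : ℂ, Z = y • ((bettiCohomology.map Φ.hom.hom.hom 1).hom).baseChange ℂ := by
  classical
  have hHD : exists_isReal_hodgeModel := exists_isReal_hodgeModel_holds
  have hI : hodgePQ_independent_of_hodgeModel := hodgePQ_independent_of_hodgeModel_holds
  have hP : IsSmoothProjective (E.prod E).dim (E.prod E).X := AbelianVariety.isSmoothProjective_holds
  have hXE : IsSmoothProjective E.dim E.X := AbelianVariety.isSmoothProjective_holds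
  haveI : Module.Finite ℚ (bettiCohomology (E.prod E).X 1) := finite_bettiCohomology_one _
  haveI : Module.Finite ℚ (bettiCohomology E.X 1) := finite_bettiCohomology_one _
  -- the bicone of `H¹(E × E)`
  let ιa := BettiUniverse.pullHodgeHom hHD hI hP hXE (fst E E).hom.hom.hom 1
  let πa := BettiUniverse.pullHodgeHom hHD hI hXE hP (prodLift (𝟙 E) (0 : E ⟶ E)).hom.hom.hom 1
  let ιb := BettiUniverse.pullHodgeHom hHD hI hP hXE (snd E E).hom.hom.hom 1
  let πb := BettiUniverse.pullHodgeHom hHD hI hXE hP (prodLift (0 : E ⟶ E) (𝟙 E)).hom.hom.hom 1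
  have hsumP : fst E E ≫ prodLift (𝟙 E) (0 : E ⟶ E) + snd E E ≫ prodLift (0 : E ⟶ E) (𝟙 E) = 𝟙 _ := by
    refine prod_hom_ext ?_ ?_
    · rw [Preadditive.add_comp, Category.assoc, Category.assoc, prodLift_fst, prodLift_fst, Category.comp_id,
        comp_zero, add_zero, Category.id_comp]
    · rw [Preadditive.add_comp, Category.assoc, Category.assoc, prodLift_snd, prodLift_snd, Category.comp_id,
        comp_zero, zero_add, Category.id_comp]
  have hπιa : ∀ v, πa.toLinearMap (ιa.toLinearMap v) = v := fun v => pull_pull_eq_self_of_comp_eq_id (prodLift_fst _ _) v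
  have hπιb : ∀ v, πb.toLinearMap (ιb.toLinearMap v) = v := fun v => pull_pull_eq_self_of_comp_eq_id (prodLift_snd _ _) v
  have hsum : ∀ v, ιa.toLinearMap (πa.toLinearMap v) + ιb.toLinearMap (πb.toLinearMap v) = v := fun v =>
    pull_pull_add_pull_pull_eq_self _ _ _ _ hsumP v
  have hπιa' : πa.toLinearMap ∘ₗ ιa.toLinearMap = LinearMap.id := LinearMap.ext hπιa
  have hπιb' : πb.toLinearMap ∘ₗ ιb.toLinearMap = LinearMap.id := LinearMap.ext hπιb
  have hsum' : ιa.toLinearMap ∘ₗ πa.toLinearMap + ιb.toLinearMap ∘ₗ πb.toLinearMap = LinearMap.id := LinearMap.ext hsum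
  -- complex notation
  set ia := ιa.toLinearMap.baseChange ℂ with hia
  set pa := πa.toLinearMap.baseChange ℂ with hpa
  set ib := ιb.toLinearMap.baseChange ℂ with hib
  set pb := πb.toLinearMap.baseChange ℂ with hpb
  have hpia : ∀ x, pa (ia x) = x := proj_incl_baseChange hπιa'
  have hpib : ∀ x, pb (ib x) = x := proj_incl_baseChange hπιb'
  have hsumC : ∀ y, ia (pa y) + ib (pb y) = y := incl_proj_add_baseChange hsum'
  -- the CM curve `H¹(E)`
  have heff₂ := BettiUniverse.hodge_isEffective hHD hXE 1
  set φ₂ : Module.End ℚ (bettiCohomology E.X 1) := (bettiCohomology.map χ.hom.hom.hom 1).hom with hφ₂def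
  have hφ₂E : φ₂ ∈ (BettiUniverse.hodge hHD hXE 1).endAlg := by
    have h := unop_bettiRep_mem_endAlg hHD hI (AbelianVariety.endAlgebra.of E χ)
    rwa [bettiRep_of, MulOpposite.unop_op] at h
  have hdQ : (0 : ℚ) < d := Nat.cast_pos.2 hd
  have hφ₂sq : φ₂ * φ₂ = -((d : ℚ) • 1) := bettiMapHom_mul_self hχ
  have hV₂ : Module.finrank ℚ (bettiCohomology E.X 1) = 2 := by rw [finrank_bettiCohomology_one E, hE1]
  -- pull-backs of the «matrix units» and of `Φ`
  set ΦQ : Module.End ℚ (bettiCohomology (E.prod E).X 1) := (bettiCohomology.map Φ.hom.hom.hom 1).hom with hΦQdef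
  have hpull : ∀ f : E.prod E ⟶ E.prod E, (bettiCohomology.map f.hom.hom.hom 1).hom = BettiUniverse.pull f.hom.hom.hom 1 :=
    fun f => rfl
  have hea : BettiUniverse.pull (fst E E ≫ prodLift (𝟙 E) (0 : E ⟶ E)).hom.hom.hom 1 = ιa.toLinearMap ∘ₗ πa.toLinearMap := by
    rw [CMCurveSq.pull_comp_eq]; rfl
  have hsw : BettiUniverse.pull (fst E E ≫ prodLift (0 : E ⟶ E) (𝟙 E)).hom.hom.hom 1 = ιa.toLinearMap ∘ₗ πb.toLinearMap := by
    rw [CMCurveSq.pull_comp_eq]; rfl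
  have hΦa : ΦQ ∘ₗ ιa.toLinearMap = ιa.toLinearMap ∘ₗ φ₂ := by
    change BettiUniverse.pull Φ.hom.hom.hom 1 ∘ₗ BettiUniverse.pull (fst E E).hom.hom.hom 1 =
      BettiUniverse.pull (fst E E).hom.hom.hom 1 ∘ₗ BettiUniverse.pull χ.hom.hom.hom 1
    rw [← CMCurveSq.pull_comp_eq, ← CMCurveSq.pull_comp_eq, hΦ₁]
  have hΦb : ΦQ ∘ₗ ιb.toLinearMap = ιb.toLinearMap ∘ₗ φ₂ := by
    change BettiUniverse.pull Φ.hom.hom.hom 1 ∘ₗ BettiUniverse.pull (snd E E).hom.hom.hom 1 =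
      BettiUniverse.pull (snd E E).hom.hom.hom 1 ∘ₗ BettiUniverse.pull χ.hom.hom.hom 1
    rw [← CMCurveSq.pull_comp_eq, ← CMCurveSq.pull_comp_eq, hΦ₂]
  set ΦC := ΦQ.baseChange ℂ with hΦC
  set φC := φ₂.baseChange ℂ with hφC
  have hΦia : ∀ x, ΦC (ia x) = ia (φC x) := fun x => by
    rw [hΦC, hia, ← LinearMap.comp_apply, ← LinearMap.baseChange_comp, hΦa, LinearMap.baseChange_comp, LinearMap.comp_apply]
  have hΦib : ∀ x, ΦC (ib x) = ib (φC x) := fun x => by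
    rw [hΦC, hib, ← LinearMap.comp_apply, ← LinearMap.baseChange_comp, hΦb, LinearMap.baseChange_comp, LinearMap.comp_apply]
  have hΦy : ∀ y, ΦC y = ia (φC (pa y)) + ib (φC (pb y)) := fun y => by
    conv_lhs => rw [← hsumC y]
    rw [map_add, hΦia, hΦib]
  -- `Z` commutes with `e_a = ι_a π_a`, with the swap `ι_a π_b` and with `Φ`
  have hZe : ∀ x, Z (ia (pa x)) = ia (pa (Z x)) := fun x => by
    have h := hZ (fst E E ≫ prodLift (𝟙 E) (0 : E ⟶ E))
    rw [hpull, hea, LinearMap.baseChange_comp] at h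
    have h' := LinearMap.congr_fun h x
    simpa only [Module.End.mul_apply, LinearMap.comp_apply] using h'
  have hZs : ∀ x, Z (ia (pb x)) = ia (pb (Z x)) := fun x => by
    have h := hZ (fst E E ≫ prodLift (0 : E ⟶ E) (𝟙 E))
    rw [hpull, hsw, LinearMap.baseChange_comp] at h
    have h' := LinearMap.congr_fun h x
    simpa only [Module.End.mul_apply, LinearMap.comp_apply] using h'
  have hZΦ : Z * ΦC = ΦC * Z := hZ Φ
  -- block structure
  have hpaib : ∀ z, pa (ib z) = 0 := fun z => by
    have hz := congrArg pa (hsumC (ib z))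
    rw [map_add, hpia, hpib] at hz
    exact add_eq_left.1 hz
  have hpbia : ∀ z, pb (ia z) = 0 := fun z => by
    have hz := congrArg pb (hsumC (ia z))
    rw [map_add, hpia, hpib] at hz
    exact add_eq_left.1 hz
  have hZia : ∀ x, ia (pa (Z (ia x))) = Z (ia x) := fun x => by rw [← hZe, hpia]
  have hZib : ∀ x, ib (pb (Z (ib x))) = Z (ib x) := fun x => by
    have h1 : ia (pa (Z (ib x))) = 0 := by rw [← hZe, hpaib, map_zero, map_zero]
    have h2 := hsumC (Z (ib x))
    rwa [h1, zero_add] at h2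
  -- the blocks `A = p_a Z i_a`, `B = p_b Z i_b` commute with `χ^*_ℂ`, are skew for the restricted polarizations, and coincide
  obtain ⟨ψa, hψa⟩ := WeilProductCM.exists_polarization_comp ιa πa hπιa ψ
  obtain ⟨ψb, hψb⟩ := WeilProductCM.exists_polarization_comp ιb πb hπιb ψ
  have hpaΦ : ∀ y, pa (ΦC y) = φC (pa y) := fun y => by
    rw [hΦy, map_add, hpia, hpaib, add_zero]
  have hpbΦ : ∀ y, pb (ΦC y) = φC (pb y) := fun y => by
    rw [hΦy, map_add, hpbia, hpib, zero_add]
  have hAφ : (pa ∘ₗ Z ∘ₗ ia) * φC = φC * (pa ∘ₗ Z ∘ₗ ia) := by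
    refine LinearMap.ext fun x => ?_
    change pa (Z (ia (φC x))) = φC (pa (Z (ia x)))
    rw [← hΦia, ← Module.End.mul_apply Z ΦC, hZΦ, Module.End.mul_apply, hpaΦ]
  have hBφ : (pb ∘ₗ Z ∘ₗ ib) * φC = φC * (pb ∘ₗ Z ∘ₗ ib) := by
    refine LinearMap.ext fun x => ?_
    change pb (Z (ib (φC x))) = φC (pb (Z (ib x)))
    rw [← hΦib, ← Module.End.mul_apply Z ΦC, hZΦ, Module.End.mul_apply, hpbΦ]
  have hAskew : ∀ x y, ψa.form.baseChange ℂ ((pa ∘ₗ Z ∘ₗ ia) x) y + ψa.form.baseChange ℂ x ((pa ∘ₗ Z ∘ₗ ia) y) = 0 := by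
    intro x y
    rw [hψa, baseChange_compl₁₂, baseChange_compl₁₂]
    change ψ.form.baseChange ℂ (ia (pa (Z (ia x)))) (ia y) + ψ.form.baseChange ℂ (ia x) (ia (pa (Z (ia y)))) = 0
    rw [hZia, hZia]
    exact hZskew _ _
  have hBskew : ∀ x y, ψb.form.baseChange ℂ ((pb ∘ₗ Z ∘ₗ ib) x) y + ψb.form.baseChange ℂ x ((pb ∘ₗ Z ∘ₗ ib) y) = 0 := by
    intro x y
    rw [hψb, baseChange_compl₁₂, baseChange_compl₁₂]
    change ψ.form.baseChange ℂ (ib (pb (Z (ib x)))) (ib y) + ψ.form.baseChange ℂ (ib x) (ib (pb (Z (ib y)))) = 0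
    rw [hZib, hZib]
    exact hZskew _ _
  obtain ⟨ya, hya⟩ := RankTwoCM.exists_eq_smul_of_commute_of_skew (BettiUniverse.hodge hHD hXE 1) Nat.cast_one heff₂ hV₂ ψa
    hφ₂E hdQ hφ₂sq hAφ hAskew
  obtain ⟨yb, hyb⟩ := RankTwoCM.exists_eq_smul_of_commute_of_skew (BettiUniverse.hodge hHD hXE 1) Nat.cast_one heff₂ hV₂ ψb
    hφ₂E hdQ hφ₂sq hBφ hBskew
  -- equal blocks from the swap: `p_a Z i_a = p_b Z i_b`
  have hAB : pa ∘ₗ Z ∘ₗ ia = pb ∘ₗ Z ∘ₗ ib := by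
    refine LinearMap.ext fun x => ?_
    change pa (Z (ia x)) = pb (Z (ib x))
    have h := congrArg pa (hZs (ib x))
    rw [hpib, hpia] at h
    exact h
  -- assemble
  refine ⟨ya, LinearMap.ext fun v => ?_⟩
  rw [LinearMap.smul_apply, hΦy v]
  conv_lhs => rw [← hsumC v, map_add, ← hZia, ← hZib]
  have h1 : pa (Z (ia (pa v))) = ya • φC (pa v) := by
    have := LinearMap.congr_fun hya (pa v)
    simpa only [LinearMap.comp_apply, LinearMap.smul_apply] using this
  have h2 : pb (Z (ib (pb v))) = ya • φC (pb v) := by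
    have := LinearMap.congr_fun hya (pb v)
    rw [hAB] at this
    simpa only [LinearMap.comp_apply, LinearMap.smul_apply] using this
  rw [h1, h2, map_smul, map_smul, smul_add]

/-- **F20a′ — such an operator lies in `Lie Hg(H¹(E_K × E_K)) ⊗ ℂ`**: the Hodge operator `Θ` of `H¹(E × E)` commutes with `End(E × E)^*_ℂ`
and is `ψ_ℂ`-skew, so `Θ = c Φ^*_ℂ` (F20a) with `c ≠ 0` (`Θ = 1` on `H^{1,0} ≠ 0`), and `Θ ∈ Lie Hg ⊗ ℂ` (Deligne); hence
`Z = y Φ^*_ℂ = (y/c) Θ ∈ Lie Hg ⊗ ℂ`. This is the second-block input `hY₂` of the Weil PRODUCT brick at `H₂ = H¹(E_K²)` (TABLE X row 20).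
[cite: MoonenZarhin1999LowDim, §3 Prop. (3.8)] [cite: Deligne1982HodgeCycles, I §3 Prop. 3.4] -/
theorem CMCurveSq.mem_hodgeLieC_of_commute_of_skew [HodgeTensorFacts.{0, 0}]
    (hE1 : E.dim = 1) (χ : E ⟶ E) {d : ℕ} (hd : 0 < d) (hχ : χ ≫ χ = -(d • 𝟙 E))
    (Φ : E.prod E ⟶ E.prod E) (hΦ₁ : Φ ≫ fst E E = fst E E ≫ χ) (hΦ₂ : Φ ≫ snd E E = snd E E ≫ χ)
    (ψ : (BettiUniverse.hodge exists_isReal_hodgeModel_holds (AbelianVariety.isSmoothProjective_holds (A := E.prod E)) 1).Polarization)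
    {Z : Module.End ℂ (ℂ ⊗[ℚ] bettiCohomology (E.prod E).X 1)}
    (hZ : ∀ f : E.prod E ⟶ E.prod E,
      Z * ((bettiCohomology.map f.hom.hom.hom 1).hom).baseChange ℂ = ((bettiCohomology.map f.hom.hom.hom 1).hom).baseChange ℂ * Z)
    (hZskew : ∀ x y, ψ.form.baseChange ℂ (Z x) y + ψ.form.baseChange ℂ x (Z y) = 0) :
    Z ∈ (BettiUniverse.hodge exists_isReal_hodgeModel_holds (AbelianVariety.isSmoothProjective_holds (A := E.prod E)) 1).hodgeLieC := by
  classical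
  have hHD : exists_isReal_hodgeModel := exists_isReal_hodgeModel_holds
  have hI : hodgePQ_independent_of_hodgeModel := hodgePQ_independent_of_hodgeModel_holds
  have hP : IsSmoothProjective (E.prod E).dim (E.prod E).X := AbelianVariety.isSmoothProjective_holds
  haveI : Module.Finite ℚ (bettiCohomology (E.prod E).X 1) := finite_bettiCohomology_one _
  obtain ⟨Θ, hΘ⟩ := exists_hodgeTheta (BettiUniverse.hodge hHD hP 1)
  have hΘC : Θ ∈ (BettiUniverse.hodge hHD hP 1).hodgeLieC := (BettiUniverse.hodge hHD hP 1).mem_hodgeLieC_of_forall_piece hΘ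
  have hΘcomm : ∀ f : E.prod E ⟶ E.prod E,
      Θ * ((bettiCohomology.map f.hom.hom.hom 1).hom).baseChange ℂ = ((bettiCohomology.map f.hom.hom.hom 1).hom).baseChange ℂ * Θ := by
    intro f
    have hfE : (bettiCohomology.map f.hom.hom.hom 1).hom ∈ (BettiUniverse.hodge hHD hP 1).endAlg := by
      have h := unop_bettiRep_mem_endAlg hHD hI (AbelianVariety.endAlgebra.of (E.prod E) f)
      rwa [bettiRep_of, MulOpposite.unop_op] at h
    exact commute_baseChange_of_mem_hodgeLieC (BettiUniverse.hodge hHD hP 1) hΘC ⟨_, hfE⟩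
  have hΘskew : ∀ x y, ψ.form.baseChange ℂ (Θ x) y + ψ.form.baseChange ℂ x (Θ y) = 0 := fun x y => by
    rw [formBaseChange_skew_of_mem_hodgeLieC ψ hΘC, neg_add_cancel]
  obtain ⟨c, hc⟩ := CMCurveSq.exists_eq_smul_of_commute_of_skew hE1 χ hd hχ Φ hΦ₁ hΦ₂ ψ hΘcomm hΘskew
  obtain ⟨y, hy⟩ := CMCurveSq.exists_eq_smul_of_commute_of_skew hE1 χ hd hχ Φ hΦ₁ hΦ₂ ψ hZ hZskew
  -- `c ≠ 0`: `Θ = 1` on `H^{1,0}(E × E) ≠ 0`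
  have hc0 : c ≠ 0 := by
    have hsumM := eigenMultiplicity_add_eigenMultiplicity_neg_eq_dim (E.prod E) Φ hd
      (by
        refine prod_hom_ext ?_ ?_
        · rw [Category.assoc, hΦ₁, ← Category.assoc, hΦ₁, Category.assoc, hχ]
          simp only [Preadditive.comp_neg, Preadditive.neg_comp, Preadditive.comp_nsmul, Preadditive.nsmul_comp,
            Category.comp_id, Category.id_comp]
        · rw [Category.assoc, hΦ₂, ← Category.assoc, hΦ₂, Category.assoc, hχ]
          simp only [Preadditive.comp_neg, Preadditive.neg_comp, Preadditive.comp_nsmul, Preadditive.nsmul_comp,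
            Category.comp_id, Category.id_comp])
    have hdim : (E.prod E).dim = 2 := by rw [AbelianVariety.dim_prod, hE1]
    rw [hdim, ← finrank_eigenspace_inf_piece_oneZero_eq_eigenMultiplicity hHD hI Φ,
      ← finrank_eigenspace_inf_piece_oneZero_eq_eigenMultiplicity hHD hI Φ] at hsumM
    -- one of the two summands is positive: a non-zero `x ∈ H^{1,0}`
    have hex : ∃ x ∈ (BettiUniverse.hodge hHD hP 1).piece 1 0, x ≠ 0 := by
      by_contra hno'
      have hno : ∀ x ∈ (BettiUniverse.hodge hHD hP 1).piece 1 0, x = 0 := fun x hx => by_contra fun h => hno' ⟨x, hx, h⟩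
      have hz : ∀ (cc : ℂ), Module.finrank ℂ ↥(Module.End.eigenspace (((bettiCohomology.map Φ.hom.hom.hom 1).hom).baseChange ℂ) cc ⊓
          (BettiUniverse.hodge hHD hP 1).piece 1 0) = 0 := fun cc => by
        have hbot : Module.End.eigenspace (((bettiCohomology.map Φ.hom.hom.hom 1).hom).baseChange ℂ) cc ⊓
            (BettiUniverse.hodge hHD hP 1).piece 1 0 = ⊥ :=
          eq_bot_iff.2 fun x hx => (Submodule.mem_bot ℂ).2 (hno x (Submodule.mem_inf.1 hx).2)
        rw [hbot, finrank_bot]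
      rw [hz, hz] at hsumM
      omega
    obtain ⟨x, hx, hx0⟩ := hex
    intro h0
    rw [h0, zero_smul] at hc
    have hΘx : Θ x = x := by
      have h := hΘ 1 x (by simpa using hx)
      norm_num at h
      exact h
    rw [hc, LinearMap.zero_apply] at hΘx
    exact hx0 hΘx.symm
  have hZΘ : Z = (y / c) • Θ := by
    rw [hy, hc, smul_smul, div_mul_cancel₀ y hc0]
  rw [hZΘ]
  exact Submodule.smul_mem _ _ hΘC

/-- **F20b — `Lie Hg(H¹(E_K × E_K))` is commutative**: every `X ∈ Lie Hg` commutes with `End(E × E)^*` and is `ψ`-skew, so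
`X_ℂ = y Φ^*_ℂ` (F20a) and `X = a Φ^*` with `a ∈ ℚ` (rational descent); two multiples of `Φ^*` commute («`Hg(E_K²) = U_K(1)` is a
torus»). This is the second-block input `hab₂` of the Weil PRODUCT brick at `H₂ = H¹(E_K²)` (TABLE X row 20).
[cite: MoonenZarhin1999LowDim, §3 Lemma (3.6) and Prop. (3.8)] [cite: Deligne1982HodgeCycles, I §3 Prop. 3.4] -/
theorem CMCurveSq.hodgeLie_mul_comm [HodgeTensorFacts.{0, 0}]
    (hE1 : E.dim = 1) (χ : E ⟶ E) {d : ℕ} (hd : 0 < d) (hχ : χ ≫ χ = -(d • 𝟙 E))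
    (Φ : E.prod E ⟶ E.prod E) (hΦ₁ : Φ ≫ fst E E = fst E E ≫ χ) (hΦ₂ : Φ ≫ snd E E = snd E E ≫ χ)
    (ψ : (BettiUniverse.hodge exists_isReal_hodgeModel_holds (AbelianVariety.isSmoothProjective_holds (A := E.prod E)) 1).Polarization)
    {X X' : Module.End ℚ (bettiCohomology (E.prod E).X 1)}
    (hX : X ∈ (BettiUniverse.hodge exists_isReal_hodgeModel_holds (AbelianVariety.isSmoothProjective_holds (A := E.prod E)) 1).hodgeLie)
    (hX' : X' ∈ (BettiUniverse.hodge exists_isReal_hodgeModel_holds (AbelianVariety.isSmoothProjective_holds (A := E.prod E)) 1).hodgeLie) :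
    X * X' = X' * X := by
  classical
  have hHD : exists_isReal_hodgeModel := exists_isReal_hodgeModel_holds
  have hI : hodgePQ_independent_of_hodgeModel := hodgePQ_independent_of_hodgeModel_holds
  have hP : IsSmoothProjective (E.prod E).dim (E.prod E).X := AbelianVariety.isSmoothProjective_holds
  haveI : Module.Finite ℚ (bettiCohomology (E.prod E).X 1) := finite_bettiCohomology_one _
  have hrat : ∀ X₀ ∈ (BettiUniverse.hodge hHD hP 1).hodgeLie, ∃ a : ℚ, X₀ = a • (bettiCohomology.map Φ.hom.hom.hom 1).hom := by
    intro X₀ hX₀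
    have hcomm : ∀ f : E.prod E ⟶ E.prod E, X₀.baseChange ℂ * ((bettiCohomology.map f.hom.hom.hom 1).hom).baseChange ℂ =
        ((bettiCohomology.map f.hom.hom.hom 1).hom).baseChange ℂ * X₀.baseChange ℂ := by
      intro f
      have hfE : (bettiCohomology.map f.hom.hom.hom 1).hom ∈ (BettiUniverse.hodge hHD hP 1).endAlg := by
        have h := unop_bettiRep_mem_endAlg hHD hI (AbelianVariety.endAlgebra.of (E.prod E) f)
        rwa [bettiRep_of, MulOpposite.unop_op] at h
      rw [← LinearMap.baseChange_mul, ← LinearMap.baseChange_mul, commute_of_mem_hodgeLie (BettiUniverse.hodge hHD hP 1) hX₀ ⟨_, hfE⟩]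
    have hskew := ThetaSubalgebra.formBaseChange_add_eq_zero_of_skew ψ (form_apply_add_eq_zero_of_mem_hodgeLie ψ hX₀)
    obtain ⟨y, hy⟩ := CMCurveSq.exists_eq_smul_of_commute_of_skew hE1 χ hd hχ Φ hΦ₁ hΦ₂ ψ hcomm hskew
    obtain ⟨a, ha⟩ := exists_eq_ratCast_smul_of_baseChange_eq_smul hy
    exact ⟨a, ha⟩
  obtain ⟨a, rfl⟩ := hrat X hX
  obtain ⟨b, rfl⟩ := hrat X' hX'
  rw [smul_mul_smul_comm, smul_mul_smul_comm, mul_comm a b]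

end Literature.AlgebraicGeometry.HodgeTheory

end
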